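import Literature.Probability.RandomPlanarGeometry.ConformalRestrictionProofs
import Literature.Probability.RandomPlanarGeometry.CaratheodoryHalfPlaneProofs
import Literature.Probability.RandomPlanarGeometry.ConformalRectangleProofs
import Literature.Probability.RandomPlanarGeometry.SLEExistence
import Literature.Probability.RandomPlanarGeometry.LoewnerCurveLimitDomain
import Literature.Probability.RandomPlanarGeometry.SLEProofs
import Literature.Probability.RandomPlanarGeometry.CritPercSLEProofs
import HarnessLib

/-!
# Tilted rays, I: the ray curve through a chordal uniformizing map and its slits

Crux `SymmetryUpgradeR` (stmt-CriticalPhenomena-17239, route `CardySelfRefinement`), line `SketchIdeatorTwo`,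
negative side: the lead's structural theorem behind the verdict on stubs S7 `stub_pinnedSchrammLSW` /
S5a `stub_middleDrivingMartingale` — the typed domain Markov property `ChordalFamily.IsDomainMarkov`
cannot carry Schramm's increment argument (headline in `TiltedRayFamily.lean`:
`typedSchrammPrinciple_fails`).

The straight ray `t ↦ t u` of `(ℍₒ; 0, ∞)` (`Im u > 0`) and its time-compactified image `rayCurveThrough`
under the boundary extension of a chordal uniformizing map `φ : ℍₒ → D`: a continuous injective curve from
`a` to `b`; two uniformizing maps give the same curve up to the time change `rayScale`
(`rayCurveThrough_eq_reparam_of_eqOn`); in the chart the complement of an initial ray segment is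
star-shaped and the segment is nowhere dense (`starConvex_diff_raySeg`, `subset_closure_diff_raySeg`);
the explored slit / remaining domain in the chart. Part II: `TiltedRayFamily.lean` (family, headline).

References: W. Werner, *Lectures on two-dimensional critical percolation* (2007), §3.2 (2), Lemma 3.3;
O. Schramm, Israel J. Math. 118 (2000), §1; G. F. Lawler, *Conformally Invariant Processes in the Plane*
(2005), §6.3.
-/

noncomputable section

open Set MeasureTheory Topology Filter Metric
open scoped unitInterval ENNReal NNReal
open UpperHalfPlane (upperHalfPlaneSet)

namespace Summit.CriticalPhenomena.CardyFormulaZ2.Theorems.SymmetryUpgradeR.Negative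

open Literature.Probability.RandomPlanarGeometry Literature.Probability.RandomPlanarGeometry.ChordalFamily

/-! ## Tilted rays: conformally covariant deterministic simple chord families

For `u` in the open upper half-plane, the **`u`-ray family** assigns to `(D; a, b)` the Dirac mass at
the image of the straight ray `t ↦ t u` of `(ℍₒ; 0, ∞)` under (the boundary extension of) a chordal
uniformizing map `ℍₒ → D`, `0 ↦ a`, `∞ ↦ b` — independent of the map up to reparametrisation since two
such maps differ by a dilation, which preserves the ray. For `u = i` this is the hyperbolic geodesic
(chordal SLE₀); for `u ∉ iℝ` it is NOT: under Werner's domain Markov property (conditional law in the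
SLIT domain = the family's own law there) a tilted ray is not Markov (the conformal image of the ray
in `ℍₒ ∖ [0, t u]` from the tip is not its straight continuation), but under the typed
`ChordalFamily.IsDomainMarkov` it is (`isDomainMarkov_rayFamily`), and it is conformally covariant,
chordal and non-tracing. Hence conformal covariance + the typed Markov property + chordality +
non-tracing do not single out one deterministic family, let alone force `SLE_κ`
(`typedSchrammPrinciple_fails`): Schramm's principle cannot be run on the typed axioms.
-/

section Ray

open Complex

/-- The straight ray `t ↦ t u` in direction `u`. [folklore] -/
def ray (u : ℂ) (t : ℝ≥0) : ℂ := ((t : ℝ) : ℂ) * u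

/-- The ray is continuous. [folklore] -/
theorem continuous_ray (u : ℂ) : Continuous (ray u) :=
  (continuous_ofReal.comp NNReal.continuous_coe).mul continuous_const

/-- The ray starts at `0`. [folklore] -/
@[simp] theorem ray_zero (u : ℂ) : ray u 0 = 0 := by simp [ray]

/-- Imaginary part along the ray. [folklore] -/
theorem ray_im (u : ℂ) (t : ℝ≥0) : (ray u t).im = (t : ℝ) * u.im := by
  simp [ray, mul_im]

/-- Points of the ray at positive times lie in `ℍₒ` when `Im u > 0`. [folklore] -/
theorem ray_mem_upperHalfPlaneSet {u : ℂ} (hu : 0 < u.im) {t : ℝ≥0} (ht : 0 < t) :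
    ray u t ∈ upperHalfPlaneSet := by
  change 0 < (ray u t).im
  rw [ray_im]
  exact mul_pos (NNReal.coe_pos.2 ht) hu

/-- Points of the ray lie in the closed half-plane when `Im u > 0`. [folklore] -/
theorem ray_im_nonneg {u : ℂ} (hu : 0 < u.im) (t : ℝ≥0) : 0 ≤ (ray u t).im := by
  rw [ray_im]
  exact mul_nonneg t.2 hu.le

/-- The ray tends to infinity (`u ≠ 0`). [folklore] -/
theorem tendsto_ray_cocompact {u : ℂ} (hu : u ≠ 0) : Tendsto (ray u) atTop (cocompact ℂ) := by
  apply tendsto_cocompact_of_tendsto_norm_atTop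
  have h : (fun t : ℝ≥0 => ‖ray u t‖) = fun t : ℝ≥0 => (t : ℝ) * ‖u‖ := by
    funext t
    simp [ray]
  rw [h]
  exact (NNReal.tendsto_coe_atTop.2 tendsto_id).atTop_mul_const (norm_pos_iff.2 hu)

/-- The ray is injective (`u ≠ 0`). [folklore] -/
theorem ray_injective {u : ℂ} (hu : u ≠ 0) : Function.Injective (ray u) := by
  intro s t h
  have h' : ((s : ℝ) : ℂ) = ((t : ℝ) : ℂ) := mul_right_cancel₀ hu h
  exact_mod_cast h'

/-- Dilations act on the ray by rescaling time. [folklore] -/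
theorem smul_ray (u : ℂ) (a t : ℝ≥0) : (a : ℝ) • ray u t = ray u (a * t) := by
  simp only [ray, NNReal.coe_mul, ofReal_mul, real_smul]
  ring

/-- A point `z` with `z * conj u` real is a real multiple of `u` (`u ≠ 0`). [folklore] -/
theorem eq_smul_of_im_mul_conj_eq_zero {u z : ℂ} (hu : u ≠ 0) (h : (z * (starRingEnd ℂ) u).im = 0) :
    z = ((z * (starRingEnd ℂ) u).re / Complex.normSq u) • u := by
  have hn : (Complex.normSq u : ℂ) ≠ 0 := by exact_mod_cast (Complex.normSq_pos.2 hu).ne'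
  have hreal : z * (starRingEnd ℂ) u = ((z * (starRingEnd ℂ) u).re : ℂ) := by
    apply Complex.ext <;> simp [h]
  have key : z * (Complex.normSq u : ℂ) = ((z * (starRingEnd ℂ) u).re : ℂ) * u := by
    rw [← hreal, mul_assoc, mul_comm ((starRingEnd ℂ) u) u, Complex.mul_conj]
  rw [real_smul, ofReal_div]
  field_simp
  rw [mul_comm] at key
  rw [mul_comm, ← key, mul_comm]

variable {D D' : DobrushinDomain}

/-- **The ray curve through a chordal uniformizing map is continuous**: the time-compactified image
`s ↦ Φ (ray u (s / (1 - s)))`, `1 ↦ b` (Carathéodory continuity of `Φ = φ.boundaryExtension` on `ℍ̄`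
and `Φ → b` at infinity). [folklore] -/
theorem continuous_nodeValue_ray {u : ℂ} (hu : 0 < u.im) {φ : ConformalEquiv upperHalfPlaneSet D.carrier}
    (hφ : D.IsChordalUniformizing φ) : Continuous (nodeValue φ.boundaryExtension (D.pt 1) (ray u)) :=
  continuous_nodeValue
    ((JordanDomain.continuousOn_boundaryExtension_holds D.toJordanDomain φ).mono
      (by rw [ConformalEquiv.closure_upperHalfPlaneSet_eq]))
    (MarkedDomain.IsChordalUniformizing.tendsto_boundaryExtension_cocompact hφ)
    (continuous_ray u) (fun t => ray_im_nonneg hu t) (tendsto_ray_cocompact (fun h0 => by rw [h0] at hu; simp at hu))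

/-- The **ray curve through the uniformizing map `φ`** of `(D; a, b)`. [folklore] -/
def rayCurveThrough {u : ℂ} (hu : 0 < u.im) {φ : ConformalEquiv upperHalfPlaneSet D.carrier}
    (hφ : D.IsChordalUniformizing φ) : Curve ℂ :=
  ⟨⟨nodeValue φ.boundaryExtension (D.pt 1) (ray u), continuous_nodeValue_ray hu hφ⟩⟩

/-- The ray curve IS the compactified image of the ray. [folklore] -/
theorem isCompactifiedImage_rayCurveThrough {u : ℂ} (hu : 0 < u.im)
    {φ : ConformalEquiv upperHalfPlaneSet D.carrier} (hφ : D.IsChordalUniformizing φ) :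
    IsCompactifiedImage φ.boundaryExtension (ray u) (D.pt 1) (rayCurveThrough hu hφ) :=
  ⟨fun _ hs => nodeValue_of_lt _ _ _ hs, nodeValue_one _ _ _⟩

/-- Values of the ray curve before time `1`. [folklore] -/
theorem rayCurveThrough_apply_of_lt {u : ℂ} (hu : 0 < u.im)
    {φ : ConformalEquiv upperHalfPlaneSet D.carrier} (hφ : D.IsChordalUniformizing φ) {s : I}
    (hs : (s : ℝ) < 1) : rayCurveThrough hu hφ s = φ.boundaryExtension (ray u (rayParam s)) :=
  nodeValue_of_lt _ _ _ hs

/-- The ray curve ends at `b`. [folklore] -/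
theorem rayCurveThrough_apply_one {u : ℂ} (hu : 0 < u.im)
    {φ : ConformalEquiv upperHalfPlaneSet D.carrier} (hφ : D.IsChordalUniformizing φ) :
    rayCurveThrough hu hφ 1 = D.pt 1 :=
  nodeValue_one _ _ _

/-- The ray curve starts at `a`. [folklore] -/
theorem rayCurveThrough_apply_zero {u : ℂ} (hu : 0 < u.im)
    {φ : ConformalEquiv upperHalfPlaneSet D.carrier} (hφ : D.IsChordalUniformizing φ) :
    rayCurveThrough hu hφ 0 = D.pt 0 := by
  rw [rayCurveThrough_apply_of_lt hu hφ (by norm_num), rayParam_zero, ray_zero, hφ.boundaryExtension_zero]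

/-- At times `0 < s < 1` the ray curve is `φ` of a point of `ℍₒ`, hence lies in `D`. [folklore] -/
theorem rayCurveThrough_apply_mem {u : ℂ} (hu : 0 < u.im)
    {φ : ConformalEquiv upperHalfPlaneSet D.carrier} (hφ : D.IsChordalUniformizing φ) {s : I}
    (h0 : 0 < (s : ℝ)) (hs : (s : ℝ) < 1) :
    rayCurveThrough hu hφ s = φ (ray u (rayParam s)) ∧ ray u (rayParam s) ∈ upperHalfPlaneSet ∧
      rayCurveThrough hu hφ s ∈ D.carrier := by
  have hpos : 0 < rayParam s := by
    change (0 : ℝ) < (rayParam s : ℝ)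
    rw [coe_rayParam]
    exact div_pos h0 (sub_pos.2 hs)
  have hmem := ray_mem_upperHalfPlaneSet hu hpos
  have heq : rayCurveThrough hu hφ s = φ (ray u (rayParam s)) := by
    rw [rayCurveThrough_apply_of_lt hu hφ hs, φ.boundaryExtension_eq hmem]
  exact ⟨heq, hmem, heq ▸ φ.mapsTo hmem⟩

/-- **Two uniformizing maps give the same ray curve up to a Möbius time change.** If
`ψ = φ ∘ (c • ·)` on `ℍₒ` then the ray curve through `ψ` is the ray curve through `φ` reparametrised
by `rayScale c`. [folklore] -/
theorem rayCurveThrough_eq_reparam_of_eqOn {u : ℂ} (hu : 0 < u.im)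
    {φ ψ : ConformalEquiv upperHalfPlaneSet D.carrier} (hφ : D.IsChordalUniformizing φ)
    (hψ : D.IsChordalUniformizing ψ) {c : ℝ} (hc : 0 < c)
    (h : EqOn ψ ((ConformalEquiv.smulUpperHalfPlane c hc).trans φ) upperHalfPlaneSet) :
    rayCurveThrough hu hψ = (rayCurveThrough hu hφ).reparam (rayScale c hc) := by
  set a : ℝ≥0 := ⟨c, hc.le⟩ with ha
  have ha0 : a ≠ 0 := pos_iff_ne_zero.1 (NNReal.coe_pos.1 (show (0 : ℝ) < (a : ℝ) from hc))
  have hext := ConformalEquiv.boundaryExtension_eq_of_eqOn_smul_trans φ ψ hc h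
  have h1 : IsCompactifiedImage φ.boundaryExtension (fun t => ray u (a * t)) (D.pt 1)
      (rayCurveThrough hu hψ) := by
    refine ⟨fun s hs => ?_, rayCurveThrough_apply_one hu hψ⟩
    rw [rayCurveThrough_apply_of_lt hu hψ hs, hext]
    change φ.boundaryExtension ((a : ℝ) • ray u (rayParam s)) = _
    rw [smul_ray]
  have h2 := (isCompactifiedImage_rayCurveThrough hu hφ).comp_mul ha0
  exact h1.unique h2

/-! ### The slit of the ray chord in the half-plane chart -/

/-- The functional `w ↦ Im (w conj u)` vanishes on the ray. [folklore] -/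
theorem im_ray_mul_conj (u : ℂ) (t : ℝ≥0) : (ray u t * (starRingEnd ℂ) u).im = 0 := by
  rw [ray, mul_assoc, Complex.mul_conj]
  simp

/-- The functional `w ↦ Im (w conj u)` is real-linear in the sense needed below. [folklore] -/
theorem im_add_smul_mul_conj (u w d : ℂ) (ε : ℝ) :
    ((w + ε • d) * (starRingEnd ℂ) u).im = (w * (starRingEnd ℂ) u).im + ε * (d * (starRingEnd ℂ) u).im := by
  rw [add_mul, Complex.add_im, Complex.real_smul, mul_assoc, Complex.im_ofReal_mul]

/-- **The complement of an initial ray segment in `ℍₒ` is star-shaped** about any later point of the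
ray. [folklore] -/
theorem starConvex_diff_raySeg {u : ℂ} (hu : 0 < u.im) (T : ℝ≥0) :
    StarConvex ℝ (ray u (T + 1)) (upperHalfPlaneSet \ ray u '' Set.Ioc 0 T) := by
  have hu0 : u ≠ 0 := (fun h0 => by rw [h0] at hu; simp at hu)
  have hconv : Convex ℝ upperHalfPlaneSet := convex_halfSpace_gt Complex.imLm.isLinear 0
  have hw₀ : ray u (T + 1) ∈ upperHalfPlaneSet := ray_mem_upperHalfPlaneSet hu (by positivity)
  intro z hz θ₁ θ₂ hθ₁ hθ₂ hθ
  refine ⟨hconv hw₀ hz.1 hθ₁ hθ₂ hθ, ?_⟩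
  rintro ⟨t₀, ⟨ht₀0, ht₀T⟩, hp⟩
  -- the functional `L w = Im (w conj u)` kills the ray: `θ₂ L z = 0`
  have hL : θ₂ * (z * (starRingEnd ℂ) u).im = 0 := by
    have h := congrArg (fun w => (w * (starRingEnd ℂ) u).im) hp
    rw [im_ray_mul_conj, show θ₁ • ray u (T + 1) + θ₂ • z = θ₁ • ray u (T + 1) + θ₂ • z from rfl,
      add_mul, Complex.add_im, Complex.real_smul, Complex.real_smul, mul_assoc, mul_assoc,
      Complex.im_ofReal_mul, Complex.im_ofReal_mul, im_ray_mul_conj, mul_zero, zero_add] at h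
    exact h.symm
  rcases mul_eq_zero.1 hL with h2 | hLz
  · -- `θ₂ = 0`: the point is `w₀ = ray u (T + 1)`, which is not in the segment
    subst h2
    have h1 : θ₁ = 1 := by linarith
    subst h1
    rw [one_smul, zero_smul, add_zero] at hp
    have heq := ray_injective hu0 hp
    have : (T : ℝ) + 1 ≤ T := by
      have h := ht₀T
      rw [heq] at h
      exact_mod_cast h
    linarith
  · -- `z` on the line `ℝ u`: `z = λ u` with `λ > T`; the combination has coefficient `> T`
    set lam : ℝ := (z * (starRingEnd ℂ) u).re / Complex.normSq u with hlam
    have hz' : z = lam • u := eq_smul_of_im_mul_conj_eq_zero hu0 hLz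
    have hlam_pos : 0 < lam := by
      have h : 0 < z.im := hz.1
      rw [hz', Complex.real_smul, Complex.im_ofReal_mul] at h
      by_contra hle
      push Not at hle
      have : lam * u.im ≤ 0 := mul_nonpos_of_nonpos_of_nonneg hle hu.le
      linarith
    have hlamT : (T : ℝ) < lam := by
      by_contra hle
      push Not at hle
      refine hz.2 ⟨⟨lam, hlam_pos.le⟩, ⟨hlam_pos, hle⟩, ?_⟩
      rw [hz', ray, Complex.real_smul]
      rfl
    have hcoef : ((t₀ : ℝ) : ℂ) * u = ((θ₁ * ((T : ℝ) + 1) + θ₂ * lam : ℝ) : ℂ) * u := by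
      rw [← ray, hp, hz', ray]
      simp only [Complex.real_smul, NNReal.coe_add, NNReal.coe_one]
      push_cast
      ring
    have ht₀eq : (t₀ : ℝ) = θ₁ * ((T : ℝ) + 1) + θ₂ * lam := by
      exact_mod_cast mul_right_cancel₀ hu0 hcoef
    have hle : (t₀ : ℝ) ≤ T := by exact_mod_cast ht₀T
    have key : (t₀ : ℝ) = T + θ₁ + θ₂ * (lam - T) := by
      rw [ht₀eq]
      linear_combination (T : ℝ) * hθ
    have hnn : 0 ≤ θ₂ * (lam - T) := mul_nonneg hθ₂ (sub_nonneg.2 hlamT.le)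
    rcases eq_or_lt_of_le hθ₁ with h1 | h1
    · have h2 : θ₂ = 1 := by linarith
      rw [← h1, h2] at key
      linarith
    · linarith

/-- The later point `ray u (T + 1)` lies in the complement of the segment. [folklore] -/
theorem ray_succ_mem_diff {u : ℂ} (hu : 0 < u.im) (T : ℝ≥0) :
    ray u (T + 1) ∈ upperHalfPlaneSet \ ray u '' Set.Ioc 0 T := by
  refine ⟨ray_mem_upperHalfPlaneSet hu (by positivity), ?_⟩
  rintro ⟨t, ⟨-, htT⟩, heq⟩
  have h := ray_injective (fun h0 => by rw [h0] at hu; simp at hu) heq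
  rw [h] at htT
  have : (T : ℝ) + 1 ≤ T := by exact_mod_cast htT
  linarith

/-- **An initial ray segment is nowhere dense in `ℍₒ`.** [folklore] -/
theorem subset_closure_diff_raySeg {u : ℂ} (hu : 0 < u.im) (T : ℝ≥0) :
    upperHalfPlaneSet ⊆ closure (upperHalfPlaneSet \ ray u '' Set.Ioc 0 T) := by
  have hu0 : u ≠ 0 := (fun h0 => by rw [h0] at hu; simp at hu)
  intro w hw
  by_cases hK : w ∈ ray u '' Set.Ioc 0 T
  swap
  · exact subset_closure ⟨hw, hK⟩
  -- a transversal direction `d` with `Im d ≥ 0` and `Im (d conj u) ≠ 0`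
  set d : ℂ := if 0 ≤ u.re then Complex.I * u else -(Complex.I * u) with hd
  have hd_im : 0 ≤ d.im := by
    rw [hd]
    split_ifs with h
    · simpa using h
    · simp only [Complex.neg_im, Complex.mul_im, Complex.I_re, zero_mul, Complex.I_im, one_mul,
        zero_add, Left.nonneg_neg_iff]
      linarith
  have hd_L : (d * (starRingEnd ℂ) u).im ≠ 0 := by
    have hn : Complex.normSq u ≠ 0 := (Complex.normSq_pos.2 hu0).ne'
    rw [hd]
    split_ifs with h
    · rw [mul_assoc, Complex.mul_conj]
      simpa using hn
    · rw [neg_mul, mul_assoc, Complex.mul_conj]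
      simpa using hn
  -- the approximating points `w + (1/(n+1)) d`
  set f : ℕ → ℂ := fun n => w + ((1 : ℝ) / ((n : ℝ) + 1)) • d with hf
  have hf_tend : Tendsto f atTop (𝓝 w) := by
    have h1 : Tendsto (fun n : ℕ => ((1 : ℝ) / ((n : ℝ) + 1)) • d) atTop (𝓝 ((0 : ℝ) • d)) :=
      tendsto_one_div_add_atTop_nhds_zero_nat.smul_const d
    have h2 := (tendsto_const_nhds (x := w) (f := (atTop : Filter ℕ))).add h1
    rw [zero_smul, add_zero] at h2
    exact h2
  have hwL : (w * (starRingEnd ℂ) u).im = 0 := by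
    obtain ⟨t₀, -, rfl⟩ := hK
    exact im_ray_mul_conj u t₀
  refine mem_closure_of_tendsto hf_tend (Eventually.of_forall fun n => ⟨?_, ?_⟩)
  · -- in `ℍₒ`
    change 0 < (f n).im
    have hw' : 0 < w.im := hw
    simp only [hf, Complex.add_im, Complex.real_smul, Complex.im_ofReal_mul]
    have : 0 ≤ (1 : ℝ) / ((n : ℝ) + 1) * d.im := by positivity
    linarith
  · -- off the ray: `L (f n) = (1/(n+1)) L d ≠ 0`
    rintro ⟨t, -, ht⟩
    have h := congrArg (fun z => (z * (starRingEnd ℂ) u).im) ht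
    simp only [im_ray_mul_conj, hf] at h
    rw [im_add_smul_mul_conj, hwL, zero_add] at h
    have hpos : (0 : ℝ) < 1 / ((n : ℝ) + 1) := by positivity
    exact hd_L ((mul_eq_zero.1 h.symm).resolve_left hpos.ne')

/-- **The slit of the ray chord in the chart**: for `0 ≤ r < 1` the explored piece `(0, r]` of the
ray chord is the `φ`-image of the ray segment `(0, rayParam r]`. [folklore] -/
theorem image_rayCurveThrough_eq {u : ℂ} (hu : 0 < u.im)
    {φ : ConformalEquiv upperHalfPlaneSet D.carrier} (hφ : D.IsChordalUniformizing φ) {r : ℝ}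
    (h0 : 0 ≤ r) (hr : r < 1) :
    rayCurveThrough hu hφ '' {s : I | 0 < (s : ℝ) ∧ (s : ℝ) ≤ r} =
      φ '' (ray u '' Set.Ioc 0 (rayParam ⟨r, h0, hr.le⟩)) := by
  ext y
  constructor
  · rintro ⟨s, ⟨hs0, hsr⟩, rfl⟩
    have hs1 : (s : ℝ) < 1 := hsr.trans_lt hr
    obtain ⟨heq, -, -⟩ := rayCurveThrough_apply_mem hu hφ hs0 hs1
    refine ⟨_, ⟨rayParam s, ⟨?_, ?_⟩, rfl⟩, heq.symm⟩
    · change (0 : ℝ) < (rayParam s : ℝ)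
      rw [coe_rayParam]
      exact div_pos hs0 (sub_pos.2 hs1)
    · exact (rayParam_le_rayParam_iff hs1 hr).2 hsr
  · rintro ⟨_, ⟨t, ⟨ht0, htT⟩, rfl⟩, rfl⟩
    obtain ⟨s, hs1, rfl⟩ := exists_rayParam_eq t
    have hs0 : 0 < (s : ℝ) := by
      by_contra hle
      have : (s : ℝ) = 0 := le_antisymm (not_lt.1 hle) s.2.1
      have hs : s = 0 := Subtype.ext this
      subst hs
      rw [rayParam_zero] at ht0
      exact lt_irrefl _ ht0
    have hsr : (s : ℝ) ≤ r := (rayParam_le_rayParam_iff hs1 hr).1 htT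
    exact ⟨s, ⟨hs0, hsr⟩, (rayCurveThrough_apply_mem hu hφ hs0 hs1).1⟩

/-- **The unexplored part of the domain in the chart**: `D ∖ slit = φ (ℍₒ ∖ segment)`. [folklore] -/
theorem carrier_diff_image_rayCurveThrough_eq {u : ℂ} (hu : 0 < u.im)
    {φ : ConformalEquiv upperHalfPlaneSet D.carrier} (hφ : D.IsChordalUniformizing φ) {r : ℝ}
    (h0 : 0 ≤ r) (hr : r < 1) :
    D.carrier \ rayCurveThrough hu hφ '' {s : I | 0 < (s : ℝ) ∧ (s : ℝ) ≤ r} =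
      φ '' (upperHalfPlaneSet \ ray u '' Set.Ioc 0 (rayParam ⟨r, h0, hr.le⟩)) := by
  rw [image_rayCurveThrough_eq hu hφ h0 hr]
  have hKH : ray u '' Set.Ioc 0 (rayParam ⟨r, h0, hr.le⟩) ⊆ upperHalfPlaneSet := by
    rintro _ ⟨t, ⟨ht0, -⟩, rfl⟩
    exact ray_mem_upperHalfPlaneSet hu ht0
  have hV : φ '' upperHalfPlaneSet = D.carrier := φ.bijOn.image_eq
  ext y
  constructor
  · rintro ⟨hy, hyK⟩
    rw [← hV] at hy
    obtain ⟨w, hw, rfl⟩ := hy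
    exact ⟨w, ⟨hw, fun hwK => hyK ⟨w, hwK, rfl⟩⟩, rfl⟩
  · rintro ⟨w, ⟨hw, hwK⟩, rfl⟩
    refine ⟨φ.mapsTo hw, ?_⟩
    rintro ⟨w', hw'K, heq⟩
    have : w' = w := φ.injOn (hKH hw'K) hw heq
    exact hwK (this ▸ hw'K)

end Ray

/-- Registered form (crux stmt-CriticalPhenomena-17239, `--supports`): **the complement of an initial
ray segment in `ℍₒ` is star-shaped.** [folklore] -/
theorem raySeg_starConvex :
    ∀ u : ℂ, 0 < u.im → ∀ T : NNReal, StarConvex ℝ (ray u (T + 1)) (upperHalfPlaneSet \ ray u '' Set.Ioc 0 T) :=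
  fun _ hu T => starConvex_diff_raySeg hu T

end Summit.CriticalPhenomena.CardyFormulaZ2.Theorems.SymmetryUpgradeR.Negative

end
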